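import Mathlib

/-!
# The radical count for two-subgroup TPP triples (isotropic pairs of a bilinear form)

Solo-blind seat (MatrixMultiplication), companion note `LieExponent.md`, §3.31 (THEOREM 16, the
"radical count", and PROPOSITION 17).  Setting: a real Lie group `G` (`d = dim G`, `ι = ind 𝔤`), two
connected Lie subgroups `H₂, H₃` with `𝔥₂ ∩ 𝔥₃ = 0`, `U₀ := 𝔥₂ ⊕ 𝔥₃` of codimension `m`, and a third
member `S` (a connected `C¹` submanifold, `σ = dim S`) such that `(S, H₂, H₃)` has the triple product
property.  At a point `s ∈ S` put `V = V(s)` (right-trivialised tangent space), `W = V ∩ U₀`,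
`q = codim (V + U₀) ≥ 1` (Lemma 3.18(b) of the note), and pick `λ ∈ (V + U₀)^⊥ ∖ 0`; let `B = ω_λ`,
`B x y = λ[x,y]`, be the Kirillov form (alternating, kernel `𝔤^λ` of dimension `≥ ι`).  Then `𝔥₂, 𝔥₃`
(Lie subalgebras inside `ker λ`) are totally isotropic, and with the LEFT KERNELS
`L₂ = 𝔥₂ ∩ 𝔥₃^⊥`, `L₃ = 𝔥₃ ∩ 𝔥₂^⊥` of the pairing `b_λ = B|𝔥₂ × 𝔥₃` the note proves

  `σ = (m − q) + dim W ≤ (m − q) + rank b_λ + n₀`,  `n₀ := dim (W ∩ (L₂ ⊕ 𝔥₃))`,  `rank b_λ ≤ (d − ι)/2`,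

i.e. `δ := 3d/2 − (σ + dim H₂ + dim H₃) ≥ ι/2 + q − n₀`: the conjectured saturation bound
(S₂) `δ ≥ ι/2 + 1` holds at once unless EVERY pinning covector has `n₀ ≥ q` tangent directions whose
`𝔥₂`-component is `ω_λ`-orthogonal to `𝔥₃` ("radical directions"), and `n₀ ≤ (m − 1) + t₂` with
`t₂ = dim (W ∩ ((𝔥₂ ∩ 𝔞_λ) ⊕ 𝔥₃))`, `𝔞_λ = rad(ω_λ | ker λ)`.

This file proves the load-bearing LINEAR ALGEBRA over an arbitrary field, for an arbitrary bilinear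
form `B` on a finite-dimensional space `V` (reflexivity only where stated):

* `soloLie_isotropicPair_rank_sum_le` / `…_le'`: for totally isotropic `H₂, H₃`
  (`H_j ≤ H_j^⊥`): `(dim H₂ − dim L₂) + (dim H₃ − dim L₃) ≤ dim (H₂ + H₃) − dim ((H₂ + H₃) ∩ ker B)
  ≤ dim V − dim ker B` — an isotropic pair pairs with total rank at most `rank B`;
* `soloLie_pairing_rank_eq`: for reflexive `B`, `dim H₂ − dim L₂ = dim H₃ − dim L₃` (row rank = column
  rank of the pairing, via Mathlib's `LinearMap.dualAnnihilator_ker_eq_range_flip`); hence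
  `2 · rank b ≤ dim V − dim ker B`;
* `soloLie_radical_count`: for `W ≤ H₂ ⊔ H₃`, `L ≤ H₂`, `H₂ ⊓ H₃ = ⊥`:
  `dim W ≤ (dim H₂ − dim L) + dim (W ∩ (L + H₃))` (rank–nullity for `W → H₂/L`);
* `soloLie_orthogonal_codim_le`: for `E₁ ≤ E₂`: `dim (H ∩ E₁^⊥) − dim (H ∩ E₂^⊥) ≤ dim E₂ − dim E₁`
  (with `E₁ = U₀ ≤ E₂ = ker λ`: `dim L₂ − dim (𝔥₂ ∩ 𝔞_λ) ≤ m − 1`);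
* `soloLie_radicalCount_deficit`: the resulting bookkeeping `2δ ≥ ι + 2q − (n₂ + n₃)`, and
  `2δ ≥ ι + 2q − 2n` when the two ranks agree, in particular (S₂) when `n ≤ q − 1`.

The differential-topological inputs (existence of the pinning covector, Lemma 3.18(b); genericity of
`s`) are hypotheses of the pen-and-paper theorem and are not formalised here.  All statements are
elementary; no published source is followed.
-/

set_option linter.dupNamespace false

namespace Summit.MatrixMultiplication.MatrixMultiplication.Theorems

open Module

section Lattice

variable {K V : Type*} [Field K] [AddCommGroup V] [Module K V] [FiniteDimensional K V]

/-- Lattice bookkeeping: for `A ≤ A'`, `dim (H ∩ A') − dim (H ∩ A) ≤ dim A' − dim A`. [elementary] -/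
theorem soloLie_finrank_inf_mono_sub (H A A' : Submodule K V) (h : A ≤ A') :
    finrank K (H ⊓ A' : Submodule K V) + finrank K A ≤
      finrank K (H ⊓ A : Submodule K V) + finrank K A' := by
  have h1 := Submodule.finrank_sup_add_finrank_inf_eq (H ⊓ A') A
  have h2 : ((H ⊓ A') ⊔ A : Submodule K V) ≤ A' := sup_le inf_le_right h
  have h3 : ((H ⊓ A') ⊓ A : Submodule K V) = H ⊓ A := by
    rw [inf_assoc, inf_eq_right.2 h]
  have h4 := Submodule.finrank_mono h2
  rw [h3] at h1
  omega

/-- **Radical count** (rank–nullity for `W → H₂ / L`, `w ↦ π₂ w`): if `W ≤ H₂ ⊕ H₃` and `L ≤ H₂`,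
then `dim W + dim L ≤ dim H₂ + dim (W ∩ (L ⊕ H₃))`.  In the note: `W = V(s) ∩ U₀`, `L = L₂(λ)` the
left kernel of `b_λ`, so `dim W ≤ rank b_λ + n₀`.  [elementary] -/
theorem soloLie_radical_count (W H₂ H₃ L : Submodule K V) (hW : W ≤ H₂ ⊔ H₃) (hL : L ≤ H₂)
    (hdis : H₂ ⊓ H₃ = ⊥) :
    finrank K W + finrank K L ≤ finrank K H₂ + finrank K (W ⊓ (L ⊔ H₃) : Submodule K V) := by
  have h1 := Submodule.finrank_sup_add_finrank_inf_eq W (L ⊔ H₃)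
  have h2 := Submodule.finrank_sup_add_finrank_inf_eq L H₃
  have h3 : (L ⊓ H₃ : Submodule K V) = ⊥ := by
    rw [eq_bot_iff, ← hdis]; exact inf_le_inf_right H₃ hL
  have h4 : (W ⊔ (L ⊔ H₃) : Submodule K V) ≤ H₂ ⊔ H₃ :=
    sup_le hW (sup_le (hL.trans le_sup_left) le_sup_right)
  have h5 := Submodule.finrank_mono h4
  have h6 := Submodule.finrank_sup_add_finrank_inf_eq H₂ H₃
  rw [h3, finrank_bot] at h2
  rw [hdis, finrank_bot] at h6
  omega

end Lattice

section BilinForm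

variable {K V : Type*} [Field K] [AddCommGroup V] [Module K V] [FiniteDimensional K V]

/-- For `E₁ ≤ E₂` and any subspace `H`: `dim (H ∩ E₁^⊥) + dim E₁ ≤ dim (H ∩ E₂^⊥) + dim E₂`.
In the note (`E₁ = U₀ ≤ E₂ = ker λ`, `H = 𝔥₂`): the left kernel `L₂(λ) = 𝔥₂ ∩ U₀^⊥` exceeds
`𝔥₂ ∩ 𝔞_λ ⊇ 𝔥₂ ∩ (ker λ)^⊥` by at most `m − 1` dimensions.  [elementary] -/
theorem soloLie_orthogonal_codim_le (B : LinearMap.BilinForm K V) (H E₁ E₂ : Submodule K V)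
    (h : E₁ ≤ E₂) :
    finrank K (H ⊓ B.orthogonal E₁ : Submodule K V) + finrank K E₁ ≤
      finrank K (H ⊓ B.orthogonal E₂ : Submodule K V) + finrank K E₂ := by
  have a1 := LinearMap.BilinForm.finrank_add_finrank_orthogonal' (B := B) E₁
  have a2 := LinearMap.BilinForm.finrank_add_finrank_orthogonal' (B := B) E₂
  have a3 : (E₁ ⊓ LinearMap.ker B : Submodule K V) ≤ E₂ ⊓ LinearMap.ker B := inf_le_inf_right _ h
  have a4 := Submodule.finrank_mono a3
  have a5 : B.orthogonal E₂ ≤ B.orthogonal E₁ := LinearMap.BilinForm.orthogonal_le h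
  have a6 := soloLie_finrank_inf_mono_sub H (B.orthogonal E₂) (B.orthogonal E₁) a5
  omega

/-- **Isotropic pairs pair with total rank at most `rank B`.**  For a bilinear form `B` on a
finite-dimensional space and totally isotropic subspaces `H₂ ≤ H₂^⊥`, `H₃ ≤ H₃^⊥`, with
`L₂ := H₂ ∩ H₃^⊥`, `L₃ := H₃ ∩ H₂^⊥`:
`(dim H₂ − dim L₂) + (dim H₃ − dim L₃) ≤ dim (H₂ + H₃) − dim ((H₂ + H₃) ∩ ker B)`.
(For the Kirillov form `ω_λ` and Lie subalgebras `𝔥₂, 𝔥₃ ⊆ ker λ`: the pairing `b_λ` has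
`2 · rank b_λ ≤ rank ω_λ ≤ dim 𝔤 − ind 𝔤`.)  [elementary symplectic linear algebra] -/
theorem soloLie_isotropicPair_rank_sum_le (B : LinearMap.BilinForm K V) (H₂ H₃ : Submodule K V)
    (h₂ : H₂ ≤ B.orthogonal H₂) (h₃ : H₃ ≤ B.orthogonal H₃) :
    finrank K H₂ + finrank K H₃ + finrank K ((H₂ ⊔ H₃) ⊓ LinearMap.ker B : Submodule K V) ≤
      finrank K (H₂ ⊓ B.orthogonal H₃ : Submodule K V) +
        finrank K (H₃ ⊓ B.orthogonal H₂ : Submodule K V) + finrank K (H₂ ⊔ H₃ : Submodule K V) := by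
  have e1 := Submodule.finrank_sup_add_finrank_inf_eq H₂ (B.orthogonal H₃)
  have e2 := Submodule.finrank_sup_add_finrank_inf_eq H₃ (B.orthogonal H₂)
  have e3 := Submodule.finrank_sup_add_finrank_inf_eq (B.orthogonal H₂) (B.orthogonal H₃)
  have l1 : H₂ ⊔ B.orthogonal H₃ ≤ B.orthogonal H₂ ⊔ B.orthogonal H₃ := sup_le_sup_right h₂ _
  have l2 : H₃ ⊔ B.orthogonal H₂ ≤ B.orthogonal H₂ ⊔ B.orthogonal H₃ :=
    sup_le (h₃.trans le_sup_right) le_sup_left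
  have f1 := Submodule.finrank_mono l1
  have f2 := Submodule.finrank_mono l2
  have l3 : B.orthogonal (H₂ ⊔ H₃) ≤ B.orthogonal H₂ ⊓ B.orthogonal H₃ :=
    le_inf (LinearMap.BilinForm.orthogonal_le le_sup_left)
      (LinearMap.BilinForm.orthogonal_le le_sup_right)
  have f3 := Submodule.finrank_mono l3
  have e4 := LinearMap.BilinForm.finrank_add_finrank_orthogonal' (B := B) (H₂ ⊔ H₃)
  have f4 : finrank K (B.orthogonal H₂ ⊔ B.orthogonal H₃ : Submodule K V) ≤ finrank K V :=
    Submodule.finrank_le _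
  omega

/-- The same bound against the whole space: `(dim H₂ − dim L₂) + (dim H₃ − dim L₃) ≤ dim V − dim ker B`.
[elementary] -/
theorem soloLie_isotropicPair_rank_sum_le' (B : LinearMap.BilinForm K V) (H₂ H₃ : Submodule K V)
    (h₂ : H₂ ≤ B.orthogonal H₂) (h₃ : H₃ ≤ B.orthogonal H₃) :
    finrank K H₂ + finrank K H₃ + finrank K (LinearMap.ker B) ≤
      finrank K (H₂ ⊓ B.orthogonal H₃ : Submodule K V) +
        finrank K (H₃ ⊓ B.orthogonal H₂ : Submodule K V) + finrank K V := by
  have h := soloLie_isotropicPair_rank_sum_le B H₂ H₃ h₂ h₃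
  have e := Submodule.finrank_sup_add_finrank_inf_eq (H₂ ⊔ H₃) (LinearMap.ker B)
  have f : finrank K ((H₂ ⊔ H₃) ⊔ LinearMap.ker B : Submodule K V) ≤ finrank K V :=
    Submodule.finrank_le _
  omega

/-- **Row rank = column rank of the pairing `H₂ × H₃ → K`.**  For a reflexive bilinear form,
`dim H₂ − dim (H₂ ∩ H₃^⊥) = dim H₃ − dim (H₃ ∩ H₂^⊥)`.  [folklore; via Mathlib's
`LinearMap.dualAnnihilator_ker_eq_range_flip`] -/
theorem soloLie_pairing_rank_eq (B : LinearMap.BilinForm K V) (hB : B.IsRefl)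
    (H₂ H₃ : Submodule K V) :
    finrank K H₂ + finrank K (H₃ ⊓ B.orthogonal H₂ : Submodule K V) =
      finrank K H₃ + finrank K (H₂ ⊓ B.orthogonal H₃ : Submodule K V) := by
  let P : H₂ →ₗ[K] H₃ →ₗ[K] K := B.compl₁₂ H₂.subtype H₃.subtype
  have hPapp : ∀ (x : H₂) (y : H₃), P x y = B (x : V) (y : V) := fun x y => rfl
  have hk2 : LinearMap.ker P = Submodule.comap H₂.subtype (B.orthogonal H₃) := by
    ext x
    simp only [LinearMap.mem_ker, Submodule.mem_comap, Submodule.coe_subtype,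
      LinearMap.BilinForm.mem_orthogonal_iff]
    constructor
    · intro hx n hn
      have h0 : P x ⟨n, hn⟩ = 0 := by rw [hx]; rfl
      rw [hPapp] at h0
      exact hB _ _ h0
    · intro hx
      apply LinearMap.ext
      intro y
      rw [hPapp, LinearMap.zero_apply]
      exact hB _ _ (hx y y.2)
  have hk3 : LinearMap.ker P.flip = Submodule.comap H₃.subtype (B.orthogonal H₂) := by
    ext y
    simp only [LinearMap.mem_ker, Submodule.mem_comap, Submodule.coe_subtype,
      LinearMap.BilinForm.mem_orthogonal_iff]
    constructor
    · intro hy n hn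
      have h0 : P.flip y ⟨n, hn⟩ = 0 := by rw [hy]; rfl
      rw [LinearMap.flip_apply, hPapp] at h0
      exact h0
    · intro hy
      apply LinearMap.ext
      intro x
      rw [LinearMap.flip_apply, hPapp, LinearMap.zero_apply]
      exact hy x x.2
  have r1 : finrank K (LinearMap.ker P) + finrank K (LinearMap.range P.flip) = finrank K H₂ := by
    rw [← LinearMap.dualAnnihilator_ker_eq_range_flip]
    exact Subspace.finrank_add_finrank_dualAnnihilator_eq _
  have r2 := LinearMap.finrank_range_add_finrank_ker P.flip
  have c2 : finrank K (Submodule.comap H₂.subtype (B.orthogonal H₃)) =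
      finrank K (H₂ ⊓ B.orthogonal H₃ : Submodule K V) := by
    rw [← Submodule.finrank_map_subtype_eq H₂ (Submodule.comap H₂.subtype (B.orthogonal H₃)),
      Submodule.map_comap_subtype]
  have c3 : finrank K (Submodule.comap H₃.subtype (B.orthogonal H₂)) =
      finrank K (H₃ ⊓ B.orthogonal H₂ : Submodule K V) := by
    rw [← Submodule.finrank_map_subtype_eq H₃ (Submodule.comap H₃.subtype (B.orthogonal H₂)),
      Submodule.map_comap_subtype]
  rw [hk2, c2] at r1
  rw [hk3, c3] at r2
  omega

/-- **`2 · rank b ≤ rank B` for an isotropic pair of a reflexive form** (alternating and symmetric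
forms are reflexive): `2 · (dim H₂ − dim L₂) ≤ dim V − dim ker B`.  For the Kirillov form this is
`rank b_λ ≤ (dim 𝔤 − dim 𝔤^λ)/2 ≤ (d − ι)/2 = N_G`.  [elementary] -/
theorem soloLie_isotropicPair_two_rank_le (B : LinearMap.BilinForm K V) (hB : B.IsRefl)
    (H₂ H₃ : Submodule K V) (h₂ : H₂ ≤ B.orthogonal H₂) (h₃ : H₃ ≤ B.orthogonal H₃) :
    2 * finrank K H₂ + finrank K (LinearMap.ker B) ≤
      2 * finrank K (H₂ ⊓ B.orthogonal H₃ : Submodule K V) + finrank K V := by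
  have h := soloLie_isotropicPair_rank_sum_le' B H₂ H₃ h₂ h₃
  have e := soloLie_pairing_rank_eq B hB H₂ H₃
  omega

end BilinForm

section Bookkeeping

/-- **THEOREM 16 of the note, bookkeeping.**  Natural-number shadow of the radical count for a
two-subgroup TPP triple at a point `s`: `d = dim G`, `ι = ind 𝔤 ≤ z = dim 𝔤^λ`, `m = codim U₀`,
`q = codim (V + U₀)` (`1 ≤ q ≤ m`; only `σ + q = w + m` is used), `σ = dim S = (m − q) + w` with `w = dim (V ∩ U₀)`,
`w ≤ rⱼ + nⱼ` (`soloLie_radical_count` from either side, `r₂ = dim 𝔥₂ − dim L₂`,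
`r₃ = dim 𝔥₃ − dim L₃`), `r₂ + r₃ + z ≤ d` (`soloLie_isotropicPair_rank_sum_le'`).  Writing
`2δ = d + 2m − 2σ` (so that `δ = 3d/2 − Σ`):
(i) `2δ ≥ ι + 2q − (n₂ + n₃)`; (ii) if `r₂ = r₃` (reflexive forms, `soloLie_pairing_rank_eq`) then
`2δ ≥ ι + 2q − 2·n₂`; (iii) hence the saturation bound (S₂) `2δ ≥ ι + 2` as soon as `n₂ + 1 ≤ q`.
[bookkeeping; the geometric inputs are hypotheses] -/
theorem soloLie_radicalCount_deficit (d ι z m q σ w r₂ r₃ n₂ n₃ : ℕ)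
    (hσ : σ + q = w + m) (hw₂ : w ≤ r₂ + n₂) (hw₃ : w ≤ r₃ + n₃)
    (hr : r₂ + r₃ + z ≤ d) (hz : ι ≤ z) :
    (ι + 2 * q ≤ (d + 2 * m - 2 * σ) + (n₂ + n₃)) ∧
    (r₂ = r₃ → ι + 2 * q ≤ (d + 2 * m - 2 * σ) + 2 * n₂) ∧
    (r₂ = r₃ → n₂ + 1 ≤ q → ι + 2 ≤ d + 2 * m - 2 * σ) := by
  refine ⟨?_, ?_, ?_⟩
  · omega
  · intro h; omega
  · intro h h'; omega

/-- The `t₂`-form of the count: with `n₂ ≤ (m − 1) + t₂` (`soloLie_orthogonal_codim_le` for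
`U₀ ≤ ker λ` plus `soloLie_finrank_inf_mono_sub`), equal ranks give `2δ ≥ ι + 2q + 2 − 2m − 2t₂`,
i.e. `δ ≥ ι/2 + q + 1 − m − t₂`.  [bookkeeping] -/
theorem soloLie_radicalCount_deficit_t (d ι z m q σ w r n₂ t₂ : ℕ)
    (hσ : σ + q = w + m) (hw : w ≤ r + n₂) (hr : 2 * r + z ≤ d) (hz : ι ≤ z)
    (hn : n₂ + 1 ≤ m + t₂) :
    ι + 2 * q + 2 ≤ (d + 2 * m - 2 * σ) + 2 * m + 2 * t₂ := by
  omega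

end Bookkeeping

end Summit.MatrixMultiplication.MatrixMultiplication.Theorems
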